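import Summits.NavierStokesRegularity.NavierStokesRegularity.Theorems.LocalSineTubeDoorGenericDoor
import Summits.NavierStokesRegularity.NavierStokesRegularity.Theorems.ClockStretchingLawClockCeilingZoomScaling
import Summits.NavierStokesRegularity.NavierStokesRegularity.Theorems.PoloidalWindowDoorPoloidalWindowRigidityWindow
import Summits.NavierStokesRegularity.NavierStokesRegularity.Theorems.PoloidalWindowDoorPoloidalWindowRigidityFlat
import Summits.NavierStokesRegularity.NavierStokesRegularity.Theorems.OddMorawetzMorawetzKillsTypeISelfSimilarRigidity
import Literature.Analysis.FluidPDE.SelfSimilar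
import Literature.Analysis.FluidPDE.KatoLocalBoundedPicard
import Literature.Analysis.UnboundedOperators.HeatExtensionUniformTail
import Summits.NavierStokesRegularity.NavierStokesRegularity.Theorems.SqueezeCycleNoApexTypeIProfileTypeIBoundIdle
import Summits.NavierStokesRegularity.NavierStokesRegularity.Theorems.RellichScarApexLocalisationIrrotHalfspaceLiouville
import Literature.Analysis.FluidPDE.TypeIAncientMildDecay
import Literature.Analysis.FluidPDE.TaoEnstrophyLocalisation
import Literature.Analysis.Calculus.DifferenceQuotientHolder
import Literature.Analysis.FluidPDE.BarkerPrange2020VorticityAlignmentTypeIHolds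
import HarnessLib
import Summits.NavierStokesRegularity.NavierStokesRegularity.Theorems.LocalConicalFinalStateDoorApexRigidityOfBU

/-!
# nsreg-p1 ROUND-17 door S18 «LocalConicalFinalStateDoor» (STAGED, HOLD) — K2 skeleton v2 (LINE OF RECORD), kernel-resident:
# K2 `ConicalApexRigidity` ⇐ the ONE open stub `ExteriorDifferenceBU` (window spread PROVED)

Tree landing of the v2 cut of the planner's K2 skeleton (`route-conical/bc/ConicalApexRigidity_birth_v2.lean` 2cd087ed0cde242d,
nsreg-p1 g15, §"BC3 BIRTH SKELETON v2"): uniform exterior two-flow backward uniqueness across the apex (`ExteriorDifferenceBU`,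
L, THE content, text verbatim as a hypothesis) + window spread (PROVED) ⇒ K2.

* `windowSpread` — text of v2 child 2 `WindowSpread`, PROVED: two door-class flows that coincide on an exterior window
  `{‖y‖ > R} × (−T₁, 0)` coincide on `ℝ³ × (−T₁, 0)` (slice analyticity `IsTypeIAncientMild.analyticOnNhd_slice_univ` +
  identity theorem);
* `notSingular_of_zero_window`, `windowedSelfSimilar_zero` — a profile vanishing on a top window is not backward-singular;
  windowed self-similarity with one window for all scales forces vanishing on the window (Tsai, windowed);
* `conicalApexRigidity_of_exteriorDifferenceBU` — **K2 (text verbatim) ⇐ `ExteriorDifferenceBU` (text verbatim)**;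
  `conicalApexRigidity_of₂` — the planner's two-hypothesis composition.

Seat nsreg-p6 g10 (THEOREMS-ONLY door sequels, DIRECTOR-NS g8 #32 (2)/#36); credit: statements and proofs nsreg-p1 g15.
WHAT THIS IS NOT: not NS regularity; not K2 and not `ExteriorDifferenceBU` (OPEN, the line's content: ESS-exterior Carleman
for the difference of two flows across the apex); no route is opened (S18 staged, HOLD).
-/

noncomputable section

-- the summit and its single sub-problem share the name (CONVENTIONS §1)
set_option linter.dupNamespace false

namespace Summit.NavierStokesRegularity.NavierStokesRegularity.Theorems.LocalConicalFinalStateDoorApexRigidityOfExteriorBU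

open MeasureTheory Set Function Filter Topology Metric
open scoped RealInnerProductSpace InnerProductSpace NNReal ENNReal
open Literature.Analysis Literature.Analysis.FluidPDE
open Literature.Analysis.UnboundedOperators (heatExtension)
open Summit.NavierStokesRegularity.NavierStokesRegularity.Theorems
open Summit.NavierStokesRegularity.NavierStokesRegularity.Theorems.PoloidalWindowDoorPoloidalWindowRigidityWindow
open Summit.NavierStokesRegularity.NavierStokesRegularity.Theorems.PoloidalWindowDoorPoloidalWindowRigidityFlat
  (not_backwardSingular_of_zero)
open Summit.NavierStokesRegularity.NavierStokesRegularity.Theorems.RellichScarApexLocalisationIrrotHalfspaceLiouville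
  (not_isBackwardSingularPoint_of_topCurlVanishing_halfspace)
open Summit.NavierStokesRegularity.NavierStokesRegularity.Theorems.NoApexKNSS (exists_pressure_typeIBound_lt_top)
open Literature.Analysis.Calculus (norm_fderiv_fderiv_le_norm_iteratedFDeriv_two)
open Summit.NavierStokesRegularity.NavierStokesRegularity.Theorems.LocalConicalFinalStateDoorApexRigidityOfBU (doorClass_nsRescale doorClass_selfSimilar_zero)
/-- **v2 child 2 `(∀ (C₁ C₂ R T₁ : ℝ) (v₁ v₂ : ℝ → (EuclideanSpace ℝ (Fin 3)) → (EuclideanSpace ℝ (Fin 3))),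
    HasTypeITimeDecay C₁ v₁ →
    ContinuousOn (Function.uncurry v₁) (Set.Iio (0 : ℝ) ×ˢ Set.univ) →
    (∀ s t : ℝ, s < t → t < 0 → ∀ x, v₁ t x =
      UnboundedOperators.heatExtension (v₁ s) (t - s) x - oseenDuhamel 1 s v₁ v₁ t x) →
    (∀ t < 0, VectorCalculus.IsDivFree (v₁ t)) →
    HasTypeITimeDecay C₂ v₂ →
    ContinuousOn (Function.uncurry v₂) (Set.Iio (0 : ℝ) ×ˢ Set.univ) →
    (∀ s t : ℝ, s < t → t < 0 → ∀ x, v₂ t x =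
      UnboundedOperators.heatExtension (v₂ s) (t - s) x - oseenDuhamel 1 s v₂ v₂ t x) →
    (∀ t < 0, VectorCalculus.IsDivFree (v₂ t)) →
    (∀ t : ℝ, -T₁ < t → t < 0 → ∀ y : (EuclideanSpace ℝ (Fin 3)), R < ‖y‖ → v₁ t y = v₂ t y) →
    ∀ t : ℝ, -T₁ < t → t < 0 → v₁ t = v₂ t)` (text verbatim), PROVED**: window spread by real-analyticity of door-class slices. -/
theorem windowSpread : (∀ (C₁ C₂ R T₁ : ℝ) (v₁ v₂ : ℝ → (EuclideanSpace ℝ (Fin 3)) → (EuclideanSpace ℝ (Fin 3))),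
    HasTypeITimeDecay C₁ v₁ →
    ContinuousOn (Function.uncurry v₁) (Set.Iio (0 : ℝ) ×ˢ Set.univ) →
    (∀ s t : ℝ, s < t → t < 0 → ∀ x, v₁ t x =
      UnboundedOperators.heatExtension (v₁ s) (t - s) x - oseenDuhamel 1 s v₁ v₁ t x) →
    (∀ t < 0, VectorCalculus.IsDivFree (v₁ t)) →
    HasTypeITimeDecay C₂ v₂ →
    ContinuousOn (Function.uncurry v₂) (Set.Iio (0 : ℝ) ×ˢ Set.univ) →
    (∀ s t : ℝ, s < t → t < 0 → ∀ x, v₂ t x =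
      UnboundedOperators.heatExtension (v₂ s) (t - s) x - oseenDuhamel 1 s v₂ v₂ t x) →
    (∀ t < 0, VectorCalculus.IsDivFree (v₂ t)) →
    (∀ t : ℝ, -T₁ < t → t < 0 → ∀ y : (EuclideanSpace ℝ (Fin 3)), R < ‖y‖ → v₁ t y = v₂ t y) →
    ∀ t : ℝ, -T₁ < t → t < 0 → v₁ t = v₂ t) := by
  intro C₁ C₂ R T₁ v₁ v₂ hrate₁ hcont₁ hmild₁ hdiv₁ hrate₂ hcont₂ hmild₂ hdiv₂ hext t ht₁ ht₀
  have hA₁ : AnalyticOnNhd ℝ (v₁ t) univ :=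
    (isTypeIAncientMild_of_class hrate₁ hcont₁ hmild₁ hdiv₁).analyticOnNhd_slice_univ ht₀
  have hA₂ : AnalyticOnNhd ℝ (v₂ t) univ :=
    (isTypeIAncientMild_of_class hrate₂ hcont₂ hmild₂ hdiv₂).analyticOnNhd_slice_univ ht₀
  have hA : AnalyticOnNhd ℝ (fun y => v₁ t y - v₂ t y) univ := fun y hy => (hA₁ y hy).sub (hA₂ y hy)
  -- a point of the exterior region
  set e : (EuclideanSpace ℝ (Fin 3)) := EuclideanSpace.single 0 1 with he_def
  have he : ‖e‖ = 1 := by simp [he_def]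
  set z₀ : (EuclideanSpace ℝ (Fin 3)) := (|R| + 1) • e with hz₀_def
  have hz₀ : R < ‖z₀‖ := by
    rw [hz₀_def, norm_smul, he, mul_one, Real.norm_of_nonneg (by positivity)]
    linarith [le_abs_self R]
  have hopen : IsOpen {y : (EuclideanSpace ℝ (Fin 3)) | R < ‖y‖} := isOpen_lt continuous_const continuous_norm
  have hev : (fun y => v₁ t y - v₂ t y) =ᶠ[𝓝 z₀] 0 := by
    filter_upwards [hopen.mem_nhds hz₀] with y hy
    simp [hext t ht₁ ht₀ y hy]
  have hzero := hA.eqOn_zero_of_preconnected_of_eventuallyEq_zero isPreconnected_univ (mem_univ z₀) hev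
  funext y
  have := hzero (mem_univ y)
  simpa [sub_eq_zero] using this

/-- A profile vanishing on a top window `(−T₁, 0) × (EuclideanSpace ℝ (Fin 3))` is not backward-singular at the apex. -/
theorem notSingular_of_zero_window {v : ℝ → (EuclideanSpace ℝ (Fin 3)) → (EuclideanSpace ℝ (Fin 3))} {T₁ : ℝ} (hT₁ : 0 < T₁)
    (h : ∀ t : ℝ, -T₁ < t → t < 0 → ∀ x, v t x = 0) : ¬ IsBackwardSingularPoint v 0 := by
  intro hs
  set r : ℝ := min 1 T₁ with hr
  have hr0 : 0 < r := lt_min one_pos hT₁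
  have hr1 : r ≤ 1 := min_le_left _ _
  have hrT : r ≤ T₁ := min_le_right _ _
  have hr2 : r ^ 2 ≤ T₁ := by nlinarith
  have h1 := hs r hr0
  have hS : MeasurableSet (FluidPDE.parabolicCylinder r (0 : ℝ × (EuclideanSpace ℝ (Fin 3)))) :=
    measurableSet_Ioo.prod measurableSet_ball
  have hae : (Function.uncurry v) =ᵐ[volume.restrict (FluidPDE.parabolicCylinder r (0 : ℝ × (EuclideanSpace ℝ (Fin 3))))] 0 := by
    refine (ae_restrict_iff' hS).2 (Eventually.of_forall fun q hq => ?_)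
    obtain ⟨hq1, -⟩ := Set.mem_prod.1 hq
    have hq0 : q.1 < 0 := by
      have := hq1.2
      simpa using this
    have hq2 : -T₁ < q.1 := by
      have := hq1.1
      simp at this
      linarith
    show v q.1 q.2 = 0
    exact h q.1 hq2 hq0 q.2
  rw [eLpNorm_congr_ae hae, eLpNorm_zero] at h1
  exact ENNReal.zero_ne_top h1

/-- **Windowed self-similarity kills a door-class profile on the window** (the self-similar
extension argument). -/
theorem windowedSelfSimilar_zero {C D T₁ : ℝ} {v : ℝ → (EuclideanSpace ℝ (Fin 3)) → (EuclideanSpace ℝ (Fin 3))}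
    (hrate : HasTypeITimeDecay C v) (hdecay : HasTypeIDecay D v)
    (hcont : ContinuousOn (Function.uncurry v) (Set.Iio (0 : ℝ) ×ˢ Set.univ))
    (hmild : ∀ s t : ℝ, s < t → t < 0 → ∀ x, v t x =
      UnboundedOperators.heatExtension (v s) (t - s) x - oseenDuhamel 1 s v v t x)
    (hdiv : ∀ t < 0, VectorCalculus.IsDivFree (v t)) (hT₁ : 0 < T₁)
    (hss : ∀ c : ℝ, 0 < c → ∀ t : ℝ, -T₁ < t → t < 0 → nsRescale c v t = v t) :
    ∀ t : ℝ, -T₁ < t → t < 0 → ∀ x, v t x = 0 := by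
  -- the scale `c(t) = √(T₁/2)/√(−t)` with `c(t)² t = −T₁/2`
  set cf : ℝ → ℝ := fun t => Real.sqrt (T₁ / 2) / Real.sqrt (-t) with hcf
  have hcf_pos : ∀ t < 0, 0 < cf t := fun t ht => by
    rw [hcf]; exact div_pos (Real.sqrt_pos.2 (by linarith)) (Real.sqrt_pos.2 (by linarith))
  have hcf_sq : ∀ t < 0, cf t ^ 2 * t = -(T₁ / 2) := fun t ht => by
    rw [hcf]
    simp only []
    rw [div_pow, Real.sq_sqrt (by linarith), Real.sq_sqrt (by linarith)]
    have ht0 : t ≠ 0 := ht.ne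
    field_simp
  -- the self-similar extension
  set w : ℝ → (EuclideanSpace ℝ (Fin 3)) → (EuclideanSpace ℝ (Fin 3)) := fun t x => cf t • v (-(T₁ / 2)) (cf t • x) with hw
  -- KEY: on a window where `μ² t ∈ (−T₁, 0)`, the rescaling `v_μ` coincides with `w`
  have hkey : ∀ μ : ℝ, 0 < μ → ∀ t < 0, -T₁ < μ ^ 2 * t → ∀ x, nsRescale μ v t x = w t x := by
    intro μ hμ t ht hμt x
    have hct := hcf_pos t ht
    have hμt0 : μ ^ 2 * t < 0 := mul_neg_of_pos_of_neg (by positivity) ht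
    -- windowed self-similarity at time `μ² t` with scale `c' = c(t)/μ`
    have hc' : 0 < cf t / μ := div_pos hct hμ
    have h1 := hss (cf t / μ) hc' (μ ^ 2 * t) hμt hμt0
    have h2 : v (μ ^ 2 * t) (μ • x) = (cf t / μ) • v ((cf t / μ) ^ 2 * (μ ^ 2 * t)) ((cf t / μ) • (μ • x)) := by
      have := congrFun h1 (μ • x)
      rw [nsRescale_apply] at this
      exact this.symm
    have h3 : (cf t / μ) ^ 2 * (μ ^ 2 * t) = -(T₁ / 2) := by
      rw [← hcf_sq t ht]; field_simp
    have h4 : (cf t / μ) • (μ • x) = cf t • x := by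
      rw [smul_smul]; congr 1; field_simp
    rw [nsRescale_apply, h2, h3, h4, smul_smul]
    show (μ * (cf t / μ)) • v (-(T₁ / 2)) (cf t • x) = cf t • v (-(T₁ / 2)) (cf t • x)
    congr 1; field_simp
  -- (a) `v = w` on the window
  have hvw : ∀ t : ℝ, -T₁ < t → t < 0 → ∀ x, v t x = w t x := by
    intro t ht₁ ht₀ x
    have := hkey 1 one_pos t ht₀ (by simpa using ht₁) x
    simpa [nsRescale_apply] using this
  -- one scale per bounded window: `μ(s)² = T₁/(8(−s))` works on `[s, 0)`
  have hwin : ∀ s < 0, ∃ μ : ℝ, 0 < μ ∧ ∀ τ : ℝ, s ≤ τ → τ < 0 → -T₁ < μ ^ 2 * τ := by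
    intro s hs
    refine ⟨cf (4 * s), hcf_pos _ (by linarith), fun τ hτs hτ0 => ?_⟩
    have hpos : 0 < cf (4 * s) ^ 2 := pow_pos (hcf_pos _ (by linarith)) 2
    have hmono : cf (4 * s) ^ 2 * s ≤ cf (4 * s) ^ 2 * τ := mul_le_mul_of_nonneg_left hτs hpos.le
    have h4 := hcf_sq (4 * s) (by linarith)
    have e4 : cf (4 * s) ^ 2 * (4 * s) = 4 * (cf (4 * s) ^ 2 * s) := by ring
    have hval : cf (4 * s) ^ 2 * s = -(T₁ / 8) := by linarith
    linarith
  -- (b) `w` is door class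
  have hwrate : HasTypeITimeDecay C w := by
    intro t ht x
    have hμt : -T₁ < cf t ^ 2 * t := by rw [hcf_sq t ht]; linarith
    rw [← hkey (cf t) (hcf_pos t ht) t ht hμt x]
    exact (hrate.nsRescale (hcf_pos t ht)) t ht x
  have hwcont : ContinuousOn (Function.uncurry w) (Set.Iio (0 : ℝ) ×ˢ Set.univ) := by
    intro q hq
    obtain ⟨hq1, -⟩ := Set.mem_prod.1 hq
    have hq0 : q.1 < 0 := Set.mem_Iio.1 hq1
    obtain ⟨μ, hμ, hμwin⟩ := hwin (2 * q.1) (by linarith)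
    obtain ⟨-, -, hcont', -, -⟩ := doorClass_nsRescale hrate hdecay hcont hmild hdiv hμ
    -- `w = v_μ` on the open neighbourhood `(2 q.1, 0) × (EuclideanSpace ℝ (Fin 3))` of `q`
    have hU : Set.Ioo (2 * q.1) 0 ×ˢ (Set.univ : Set (EuclideanSpace ℝ (Fin 3))) ∈ 𝓝 q := by
      refine (isOpen_Ioo.prod isOpen_univ).mem_nhds ?_
      exact Set.mem_prod.2 ⟨⟨by linarith, hq0⟩, Set.mem_univ _⟩
    have hEq : Function.uncurry w =ᶠ[𝓝 q] Function.uncurry (nsRescale μ v) := by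
      filter_upwards [hU] with z hz
      obtain ⟨hz1, -⟩ := Set.mem_prod.1 hz
      show w z.1 z.2 = nsRescale μ v z.1 z.2
      exact (hkey μ hμ z.1 hz1.2 (hμwin z.1 hz1.1.le hz1.2) z.2).symm
    have hAt : ContinuousAt (Function.uncurry (nsRescale μ v)) q :=
      hcont'.continuousAt ((isOpen_Iio.prod isOpen_univ).mem_nhds hq)
    exact (hAt.congr_of_eventuallyEq hEq).continuousWithinAt
  have hwmild : ∀ s t : ℝ, s < t → t < 0 → ∀ x, w t x =
      UnboundedOperators.heatExtension (w s) (t - s) x - oseenDuhamel 1 s w w t x := by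
    intro s t hst ht x
    have hs : s < 0 := hst.trans ht
    obtain ⟨μ, hμ, hμwin⟩ := hwin s hs
    obtain ⟨-, -, -, hmild', -⟩ := doorClass_nsRescale hrate hdecay hcont hmild hdiv hμ
    have hEq : ∀ τ : ℝ, s ≤ τ → τ < 0 → nsRescale μ v τ = w τ := fun τ hτs hτ0 =>
      funext fun y => hkey μ hμ τ hτ0 (hμwin τ hτs hτ0) y
    have hO : oseenDuhamel 1 s w w t x = oseenDuhamel 1 s (nsRescale μ v) (nsRescale μ v) t x := by
      rw [oseenDuhamel_apply, oseenDuhamel_apply]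
      refine setIntegral_congr_fun measurableSet_Ioo fun τ hτ => ?_
      simp only [hEq τ hτ.1.le (hτ.2.trans ht)]
    rw [← hEq t hst.le ht, ← hEq s le_rfl hs, hO]
    exact hmild' s t hst ht x
  have hwdiv : ∀ t < 0, VectorCalculus.IsDivFree (w t) := by
    intro t ht
    have hμt : -T₁ < cf t ^ 2 * t := by rw [hcf_sq t ht]; linarith
    obtain ⟨-, -, -, -, hdiv'⟩ := doorClass_nsRescale hrate hdecay hcont hmild hdiv (hcf_pos t ht)
    have hEq : w t = nsRescale (cf t) v t := funext fun y => (hkey (cf t) (hcf_pos t ht) t ht hμt y).symm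
    rw [hEq]; exact hdiv' t ht
  -- (c) `w` is self-similar on the open slab
  have hwss : ∀ c : ℝ, 0 < c → ∀ t < 0, nsRescale c w t = w t := by
    intro c hc t ht
    funext x
    have hct : c ^ 2 * t < 0 := mul_neg_of_pos_of_neg (by positivity) ht
    have hcc : cf (c ^ 2 * t) = cf t / c := by
      rw [hcf]
      simp only []
      rw [show -(c ^ 2 * t) = c ^ 2 * (-t) by ring, Real.sqrt_mul' _ (by linarith),
        Real.sqrt_sq hc.le]
      field_simp
    rw [nsRescale_apply]
    show c • (cf (c ^ 2 * t) • v (-(T₁ / 2)) (cf (c ^ 2 * t) • (c • x))) = cf t • v (-(T₁ / 2)) (cf t • x)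
    rw [hcc, smul_smul, smul_smul]
    have e1 : c * (cf t / c) = cf t := by field_simp
    have e2 : cf t / c * c = cf t := by field_simp
    rw [e1, e2]
  -- (d) Tsai on `w`, then back to `v`
  have hw0 := doorClass_selfSimilar_zero hwrate hwcont hwmild hwdiv hwss
  intro t ht₁ ht₀ x
  rw [hvw t ht₁ ht₀ x]
  exact hw0 t ht₀ x

/-- **v2 BC3 composition, kernel-checked**: uniform exterior difference BU + window spread ⇒ K2. -/
theorem conicalApexRigidity_of₂ (h₁ : (∀ (C D K : ℝ), ∃ (R T₁ : ℝ), 0 < T₁ ∧ ∀ (v₁ v₂ : ℝ → (EuclideanSpace ℝ (Fin 3)) → (EuclideanSpace ℝ (Fin 3))),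
    HasTypeITimeDecay C v₁ → HasTypeIDecay D v₁ →
    ContinuousOn (Function.uncurry v₁) (Set.Iio (0 : ℝ) ×ˢ Set.univ) →
    (∀ s t : ℝ, s < t → t < 0 → ∀ x, v₁ t x =
      UnboundedOperators.heatExtension (v₁ s) (t - s) x - oseenDuhamel 1 s v₁ v₁ t x) →
    (∀ t < 0, VectorCalculus.IsDivFree (v₁ t)) →
    HasTypeITimeDecay C v₂ → HasTypeIDecay D v₂ →
    ContinuousOn (Function.uncurry v₂) (Set.Iio (0 : ℝ) ×ˢ Set.univ) →
    (∀ s t : ℝ, s < t → t < 0 → ∀ x, v₂ t x =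
      UnboundedOperators.heatExtension (v₂ s) (t - s) x - oseenDuhamel 1 s v₂ v₂ t x) →
    (∀ t < 0, VectorCalculus.IsDivFree (v₂ t)) →
    (∀ t < 0, ∀ y : (EuclideanSpace ℝ (Fin 3)), y ≠ 0 → ‖v₁ t y - v₂ t y‖ ≤ K * (-t) / ‖y‖ ^ 3) →
    ∀ t : ℝ, -T₁ < t → t < 0 → ∀ y : (EuclideanSpace ℝ (Fin 3)), R < ‖y‖ → v₁ t y = v₂ t y)) (h₂ : (∀ (C₁ C₂ R T₁ : ℝ) (v₁ v₂ : ℝ → (EuclideanSpace ℝ (Fin 3)) → (EuclideanSpace ℝ (Fin 3))),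
    HasTypeITimeDecay C₁ v₁ →
    ContinuousOn (Function.uncurry v₁) (Set.Iio (0 : ℝ) ×ˢ Set.univ) →
    (∀ s t : ℝ, s < t → t < 0 → ∀ x, v₁ t x =
      UnboundedOperators.heatExtension (v₁ s) (t - s) x - oseenDuhamel 1 s v₁ v₁ t x) →
    (∀ t < 0, VectorCalculus.IsDivFree (v₁ t)) →
    HasTypeITimeDecay C₂ v₂ →
    ContinuousOn (Function.uncurry v₂) (Set.Iio (0 : ℝ) ×ˢ Set.univ) →
    (∀ s t : ℝ, s < t → t < 0 → ∀ x, v₂ t x =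
      UnboundedOperators.heatExtension (v₂ s) (t - s) x - oseenDuhamel 1 s v₂ v₂ t x) →
    (∀ t < 0, VectorCalculus.IsDivFree (v₂ t)) →
    (∀ t : ℝ, -T₁ < t → t < 0 → ∀ y : (EuclideanSpace ℝ (Fin 3)), R < ‖y‖ → v₁ t y = v₂ t y) →
    ∀ t : ℝ, -T₁ < t → t < 0 → v₁ t = v₂ t)) :
    (∀ (C D K : ℝ) (v : ℝ → (EuclideanSpace ℝ (Fin 3)) → (EuclideanSpace ℝ (Fin 3))) (w₁ : (EuclideanSpace ℝ (Fin 3)) → (EuclideanSpace ℝ (Fin 3))),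
  HasTypeITimeDecay C v →
  HasTypeIDecay D v →
  ContinuousOn (Function.uncurry v) (Set.Iio (0 : ℝ) ×ˢ Set.univ) →
  (∀ s t : ℝ, s < t → t < 0 → ∀ x, v t x =
    UnboundedOperators.heatExtension (v s) (t - s) x - oseenDuhamel 1 s v v t x) →
  (∀ t < 0, VectorCalculus.IsDivFree (v t)) →
  (∀ c : ℝ, 0 < c → ∀ z, w₁ (c • z) = c⁻¹ • w₁ z) →
  (∀ t < 0, ∀ y : (EuclideanSpace ℝ (Fin 3)), y ≠ 0 → ‖v t y - w₁ y‖ ≤ K * (-t) / ‖y‖ ^ 3) →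
  ¬ IsBackwardSingularPoint v 0) := by
  intro C D K v w₁ hrate hdecay hcont hmild hdiv hhom hcone
  obtain ⟨R, T₁, hT₁, hBU⟩ := h₁ C D (K + K)
  -- windowed self-similarity with ONE window for all scales
  have hss : ∀ c : ℝ, 0 < c → ∀ t : ℝ, -T₁ < t → t < 0 → nsRescale c v t = v t := by
    intro c hc
    obtain ⟨hrate', hdecay', hcont', hmild', hdiv'⟩ := doorClass_nsRescale hrate hdecay hcont hmild hdiv hc
    -- the rescaled profile has the same top cone, with the same contact constant
    have hcone' : ∀ t < 0, ∀ y : (EuclideanSpace ℝ (Fin 3)), y ≠ 0 → ‖nsRescale c v t y - w₁ y‖ ≤ K * (-t) / ‖y‖ ^ 3 := by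
      intro t ht y hy
      have hct : c ^ 2 * t < 0 := mul_neg_of_pos_of_neg (by positivity) ht
      have hcy : c • y ≠ 0 := smul_ne_zero hc.ne' hy
      have h1 := hcone (c ^ 2 * t) hct (c • y) hcy
      have e : nsRescale c v t y - w₁ y = c • (v (c ^ 2 * t) (c • y) - w₁ (c • y)) := by
        rw [nsRescale_apply, hhom c hc y, smul_sub, smul_smul, mul_inv_cancel₀ hc.ne', one_smul]
      rw [e, norm_smul, Real.norm_of_nonneg hc.le]
      have hny : 0 < ‖y‖ := norm_pos_iff.2 hy
      have e2 : K * (-(c ^ 2 * t)) / ‖c • y‖ ^ 3 = c⁻¹ * (K * (-t) / ‖y‖ ^ 3) := by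
        rw [norm_smul, Real.norm_of_nonneg hc.le]
        field_simp
      rw [e2] at h1
      calc c * ‖v (c ^ 2 * t) (c • y) - w₁ (c • y)‖ ≤ c * (c⁻¹ * (K * (-t) / ‖y‖ ^ 3)) := by gcongr
        _ = K * (-t) / ‖y‖ ^ 3 := by field_simp
    have hdiff : ∀ t < 0, ∀ y : (EuclideanSpace ℝ (Fin 3)), y ≠ 0 →
        ‖nsRescale c v t y - v t y‖ ≤ (K + K) * (-t) / ‖y‖ ^ 3 := by
      intro t ht y hy
      calc ‖nsRescale c v t y - v t y‖
          ≤ ‖nsRescale c v t y - w₁ y‖ + ‖w₁ y - v t y‖ := norm_sub_le_norm_sub_add_norm_sub _ _ _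
        _ ≤ K * (-t) / ‖y‖ ^ 3 + K * (-t) / ‖y‖ ^ 3 := by
            gcongr
            · exact hcone' t ht y hy
            · rw [norm_sub_rev]; exact hcone t ht y hy
        _ = (K + K) * (-t) / ‖y‖ ^ 3 := by ring
    have hext := hBU (nsRescale c v) v hrate' hdecay' hcont' hmild' hdiv' hrate hdecay hcont hmild hdiv hdiff
    exact h₂ C C R T₁ (nsRescale c v) v hrate' hcont' hmild' hdiv' hrate hcont hmild hdiv hext
  exact notSingular_of_zero_window hT₁ (windowedSelfSimilar_zero hrate hdecay hcont hmild hdiv hT₁ hss)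

/-- **K2 `ConicalApexRigidity` (text verbatim) from the ONE open stub `ExteriorDifferenceBU` (text verbatim)** — the window
spread is a theorem (`windowSpread`). -/
theorem conicalApexRigidity_of_exteriorDifferenceBU (h₁ : (∀ (C D K : ℝ), ∃ (R T₁ : ℝ), 0 < T₁ ∧ ∀ (v₁ v₂ : ℝ → (EuclideanSpace ℝ (Fin 3)) → (EuclideanSpace ℝ (Fin 3))),
    HasTypeITimeDecay C v₁ → HasTypeIDecay D v₁ →
    ContinuousOn (Function.uncurry v₁) (Set.Iio (0 : ℝ) ×ˢ Set.univ) →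
    (∀ s t : ℝ, s < t → t < 0 → ∀ x, v₁ t x =
      UnboundedOperators.heatExtension (v₁ s) (t - s) x - oseenDuhamel 1 s v₁ v₁ t x) →
    (∀ t < 0, VectorCalculus.IsDivFree (v₁ t)) →
    HasTypeITimeDecay C v₂ → HasTypeIDecay D v₂ →
    ContinuousOn (Function.uncurry v₂) (Set.Iio (0 : ℝ) ×ˢ Set.univ) →
    (∀ s t : ℝ, s < t → t < 0 → ∀ x, v₂ t x =
      UnboundedOperators.heatExtension (v₂ s) (t - s) x - oseenDuhamel 1 s v₂ v₂ t x) →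
    (∀ t < 0, VectorCalculus.IsDivFree (v₂ t)) →
    (∀ t < 0, ∀ y : (EuclideanSpace ℝ (Fin 3)), y ≠ 0 → ‖v₁ t y - v₂ t y‖ ≤ K * (-t) / ‖y‖ ^ 3) →
    ∀ t : ℝ, -T₁ < t → t < 0 → ∀ y : (EuclideanSpace ℝ (Fin 3)), R < ‖y‖ → v₁ t y = v₂ t y)) :
    ∀ (C D K : ℝ) (v : ℝ → (EuclideanSpace ℝ (Fin 3)) → (EuclideanSpace ℝ (Fin 3))) (w₁ : (EuclideanSpace ℝ (Fin 3)) → (EuclideanSpace ℝ (Fin 3))),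
  HasTypeITimeDecay C v →
  HasTypeIDecay D v →
  ContinuousOn (Function.uncurry v) (Set.Iio (0 : ℝ) ×ˢ Set.univ) →
  (∀ s t : ℝ, s < t → t < 0 → ∀ x, v t x =
    UnboundedOperators.heatExtension (v s) (t - s) x - oseenDuhamel 1 s v v t x) →
  (∀ t < 0, VectorCalculus.IsDivFree (v t)) →
  (∀ c : ℝ, 0 < c → ∀ z, w₁ (c • z) = c⁻¹ • w₁ z) →
  (∀ t < 0, ∀ y : (EuclideanSpace ℝ (Fin 3)), y ≠ 0 → ‖v t y - w₁ y‖ ≤ K * (-t) / ‖y‖ ^ 3) →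
  ¬ IsBackwardSingularPoint v 0 :=
  conicalApexRigidity_of₂ h₁ windowSpread

end Summit.NavierStokesRegularity.NavierStokesRegularity.Theorems.LocalConicalFinalStateDoorApexRigidityOfExteriorBU

end
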